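import Literature.Computability.AlgebraicComplexity.TensorPowerAction
import Literature.Computability.AlgebraicComplexity.TensorMomentMatrix
import HarnessLib

/-!
# Unitary equivariance of the moment matrix; criticality in every unitary frame

Support file for the proof of Bürgisser–Ikenmeyer 2017, Cor. 2.9 (`det_n` and `per_n` are
polystable, `Polystability.lean`), Kempf–Ness part. For the moment matrix
`momentMatrix S` of a complex `n`-tensor (`TensorMomentMatrix.lean`) and the tensor power action
`tensorAct` (`TensorPowerAction.lean`) we prove the **equivariance**

  `momentMatrix (A • S) = A * momentMatrix S * Aᴴ`   for `Aᴴ A = 1`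

(`momentMatrix_tensorAct_of_conjTranspose_mul_self`; Ness 1984 §1, equivariance of the moment
map), by expanding both sides into sums over words and using column orthonormality of `A` in all
slots but one (`sum_ite_prod_conj_mul_eq`). Consequence
(`weightSum_tensorAct_eq_zero_of_momentMatrix_eq_smul_one`): if `momentMatrix T₀` is scalar
(`T₀` critical, e.g. `detTensor n`, `perTensor n`) then for every unitary `U` and every real `θ`
with `∑ θ = 0` the torus weights of `U • T₀` balance, `∑ j, (∑ k, θ (j k)) * ‖(U • T₀) j‖² = 0` —
the hypothesis of the Kempf–Ness closedness theorem (`KempfNessClosedOrbit.lean`).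
Everything is proved; [folklore].

## References

* L. Ness (with D. Mumford), *A stratification of the null cone via the moment map*,
  Amer. J. Math. 106 (1984), §1.
* G. Kempf, L. Ness, *The length of vectors in representation spaces*, LNM 732 (1979).
-/

noncomputable section

open Finset
open scoped Matrix

namespace Literature.Computability.AlgebraicComplexity

variable {σ : Type*} [Fintype σ] [DecidableEq σ] {n : ℕ}

/-- Summing over the words that agree with `i` off the slot `k` is summing over the letter in
slot `k`: `∑_{i' ~_k i} G i' = ∑ y, G (update i k y)`. [folklore] -/
theorem sum_ite_forall_ne_eq_sum_update (G : (Fin n → σ) → ℂ) (i : Fin n → σ) (k : Fin n) :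
    (∑ i' : Fin n → σ, if (∀ m, m ≠ k → i' m = i m) then G i' else 0) =
      ∑ y : σ, G (Function.update i k y) := by
  rw [← Finset.sum_filter]
  symm
  refine Finset.sum_nbij' (fun y => Function.update i k y) (fun i' => i' k) ?_ ?_ ?_ ?_ ?_
  · intro y _
    simp only [Finset.mem_filter, Finset.mem_univ, true_and]
    intro m hm
    rw [Function.update_of_ne hm]
  · intro i' _; exact Finset.mem_univ _
  · intro y _; simp
  · intro i' hi'
    simp only [Finset.mem_filter, Finset.mem_univ, true_and] at hi'
    funext m
    by_cases hm : m = k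
    · subst hm; simp
    · rw [Function.update_of_ne hm]; exact (hi' m hm).symm
  · intro y _; rfl

/-- Exchanging the roles of the fixed and the substituted letter in slot `k`:
`∑_{i : i k = c} H i (i[k ↦ y]) = ∑_{j : j k = y} H (j[k ↦ c]) j` (the bijection `i ↦ i[k ↦ y]`).
[folklore] -/
theorem sum_ite_apply_eq_update_swap (H : (Fin n → σ) → (Fin n → σ) → ℂ) (k : Fin n) (c y : σ) :
    (∑ i : Fin n → σ, if i k = c then H i (Function.update i k y) else 0) =
      ∑ j : Fin n → σ, if j k = y then H (Function.update j k c) j else 0 := by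
  rw [← Finset.sum_filter, ← Finset.sum_filter]
  refine Finset.sum_nbij' (fun i => Function.update i k y) (fun j => Function.update j k c)
    ?_ ?_ ?_ ?_ ?_
  · intro i _; simp
  · intro j _; simp
  · intro i hi
    simp only [Finset.mem_filter, Finset.mem_univ, true_and] at hi
    rw [Function.update_idem, ← hi, Function.update_eq_self]
  · intro j hj
    simp only [Finset.mem_filter, Finset.mem_univ, true_and] at hj
    rw [Function.update_idem, ← hj, Function.update_eq_self]
  · intro i hi
    simp only [Finset.mem_filter, Finset.mem_univ, true_and] at hi
    rw [Function.update_idem, ← hi, Function.update_eq_self]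

/-- **Column orthonormality in all slots but one**: for `Aᴴ A = 1`,
`∑_{j : j k = a} ∏_{m ≠ k} conj (A (j m) (i m)) * A (j m) (i' m) = [i = i' off k]`
(`Fintype.prod_sum` and `Aᴴ A = 1` slotwise). [folklore] -/
theorem sum_ite_prod_conj_mul_eq {A : Matrix σ σ ℂ} (hA : Aᴴ * A = 1) (i i' : Fin n → σ)
    (k : Fin n) (a : σ) :
    (∑ j : Fin n → σ, if j k = a then
        ∏ m ∈ Finset.univ.erase k, (starRingEnd ℂ) (A (j m) (i m)) * A (j m) (i' m) else 0) =
      if (∀ m, m ≠ k → i m = i' m) then 1 else 0 := by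
  have h : ∀ j : Fin n → σ, (if j k = a then
      ∏ m ∈ Finset.univ.erase k, (starRingEnd ℂ) (A (j m) (i m)) * A (j m) (i' m) else 0) =
      ∏ m, (if m = k then (if j m = a then 1 else 0)
        else (starRingEnd ℂ) (A (j m) (i m)) * A (j m) (i' m)) := by
    intro j
    rw [← Finset.mul_prod_erase Finset.univ _ (Finset.mem_univ k), if_pos rfl]
    have : ∏ m ∈ Finset.univ.erase k, (if m = k then (if j m = a then (1:ℂ) else 0)
        else (starRingEnd ℂ) (A (j m) (i m)) * A (j m) (i' m)) =
        ∏ m ∈ Finset.univ.erase k, (starRingEnd ℂ) (A (j m) (i m)) * A (j m) (i' m) :=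
      Finset.prod_congr rfl fun m hm => by rw [if_neg (Finset.ne_of_mem_erase hm)]
    rw [this]
    by_cases hj : j k = a
    · rw [if_pos hj, if_pos hj, one_mul]
    · rw [if_neg hj, if_neg hj, zero_mul]
  simp_rw [h]
  rw [← Fintype.prod_sum (fun m x => if m = k then (if x = a then (1:ℂ) else 0)
        else (starRingEnd ℂ) (A x (i m)) * A x (i' m))]
  rw [← Finset.mul_prod_erase Finset.univ _ (Finset.mem_univ k)]
  simp only [if_true]
  rw [Finset.sum_ite_eq' Finset.univ a, if_pos (Finset.mem_univ _), one_mul]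
  have : ∏ m ∈ Finset.univ.erase k, (∑ x, if m = k then (if x = a then (1:ℂ) else 0)
        else (starRingEnd ℂ) (A x (i m)) * A x (i' m)) =
      ∏ m ∈ Finset.univ.erase k, (if i m = i' m then (1:ℂ) else 0) := by
    refine Finset.prod_congr rfl fun m hm => ?_
    simp_rw [if_neg (Finset.ne_of_mem_erase hm)]
    exact sum_conj_mul_eq_of_conjTranspose_mul_self hA (i m) (i' m)
  rw [this, Finset.prod_boole]
  by_cases hall : ∀ m, m ≠ k → i m = i' m
  · rw [if_pos hall, if_pos]
    intro m hm
    exact hall m (Finset.mem_erase.mp hm).1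
  · rw [if_neg hall, if_neg]
    intro h'
    exact hall fun m hm => h' m (Finset.mem_erase.mpr ⟨hm, Finset.mem_univ m⟩)

/-- **Unitary equivariance of the moment matrix**: `mom (A • S) = A * mom S * Aᴴ` when
`Aᴴ * A = 1`. [folklore] -/
theorem momentMatrix_tensorAct_of_conjTranspose_mul_self {A : Matrix σ σ ℂ} (hA : Aᴴ * A = 1)
    (S : (Fin n → σ) → ℂ) :
    momentMatrix (tensorAct A S) = A * momentMatrix S * Aᴴ := by
  ext a b
  -- Step 1: expand the entries of `A • S` inside the moment matrix
  have hstep1 : ∀ (k : Fin n) (j : Fin n → σ), j k = a →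
      (starRingEnd ℂ) (tensorAct A S (Function.update j k b)) * tensorAct A S j =
        ∑ i, ∑ i', ((starRingEnd ℂ) (A b (i k)) * A a (i' k) * ((starRingEnd ℂ) (S i) * S i')) *
          (∏ m ∈ Finset.univ.erase k, (starRingEnd ℂ) (A (j m) (i m)) * A (j m) (i' m)) := by
    intro k j hjk
    rw [tensorAct_apply, tensorAct_apply, map_sum, Finset.sum_mul]
    refine Finset.sum_congr rfl fun i _ => ?_
    rw [Finset.mul_sum]
    refine Finset.sum_congr rfl fun i' _ => ?_
    rw [map_mul, map_prod]
    rw [← Finset.mul_prod_erase Finset.univ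
        (fun m => (starRingEnd ℂ) (A (Function.update j k b m) (i m))) (Finset.mem_univ k),
      ← Finset.mul_prod_erase Finset.univ (fun m => A (j m) (i' m)) (Finset.mem_univ k)]
    simp only [Function.update_self, hjk]
    have : ∏ m ∈ Finset.univ.erase k, (starRingEnd ℂ) (A (Function.update j k b m) (i m)) =
        ∏ m ∈ Finset.univ.erase k, (starRingEnd ℂ) (A (j m) (i m)) :=
      Finset.prod_congr rfl fun m hm => by rw [Function.update_of_ne (Finset.ne_of_mem_erase hm)]
    rw [this, Finset.prod_mul_distrib]
    ring
  -- Step 2: the left-hand side as a triple sum `∑ k ∑ i ∑ y`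
  have hL : momentMatrix (tensorAct A S) a b =
      ∑ k : Fin n, ∑ i : Fin n → σ, ∑ y : σ,
        (starRingEnd ℂ) (A b (i k)) * A a y * ((starRingEnd ℂ) (S i) * S (Function.update i k y)) := by
    rw [momentMatrix_apply]
    refine Finset.sum_congr rfl fun k _ => ?_
    -- replace the summand using Step 1
    have h2 : ∀ j : Fin n → σ,
        (if j k = a then (starRingEnd ℂ) (tensorAct A S (Function.update j k b)) * tensorAct A S j
          else 0) =
        ∑ i, ∑ i', ((starRingEnd ℂ) (A b (i k)) * A a (i' k) * ((starRingEnd ℂ) (S i) * S i')) *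
          (if j k = a then
            ∏ m ∈ Finset.univ.erase k, (starRingEnd ℂ) (A (j m) (i m)) * A (j m) (i' m) else 0) := by
      intro j
      by_cases hjk : j k = a
      · rw [if_pos hjk, hstep1 k j hjk]
        refine Finset.sum_congr rfl fun i _ => Finset.sum_congr rfl fun i' _ => ?_
        rw [if_pos hjk]
      · rw [if_neg hjk]
        symm
        exact Finset.sum_eq_zero fun i _ => Finset.sum_eq_zero fun i' _ => by
          rw [if_neg hjk, mul_zero]
    simp_rw [h2]
    rw [Finset.sum_comm]
    refine Finset.sum_congr rfl fun i _ => ?_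
    rw [Finset.sum_comm]
    -- now `∑ i' c(i,i') * ∑ j [...] = ∑ i' c(i,i') * [i ~ i'] = ∑ y ...`
    have h3 : ∀ i' : Fin n → σ,
        (∑ j : Fin n → σ, ((starRingEnd ℂ) (A b (i k)) * A a (i' k) * ((starRingEnd ℂ) (S i) * S i')) *
          (if j k = a then
            ∏ m ∈ Finset.univ.erase k, (starRingEnd ℂ) (A (j m) (i m)) * A (j m) (i' m) else 0)) =
        if (∀ m, m ≠ k → i' m = i m) then
          (starRingEnd ℂ) (A b (i k)) * A a (i' k) * ((starRingEnd ℂ) (S i) * S i') else 0 := by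
      intro i'
      rw [← Finset.mul_sum, sum_ite_prod_conj_mul_eq hA i i' k a, mul_ite, mul_one, mul_zero]
      refine if_congr ⟨fun h m hm => (h m hm).symm, fun h m hm => (h m hm).symm⟩ rfl rfl
    simp_rw [h3]
    rw [sum_ite_forall_ne_eq_sum_update]
    refine Finset.sum_congr rfl fun y _ => ?_
    rw [Function.update_self]
  -- Step 3: the right-hand side as the same triple sum
  have hR : (A * momentMatrix S * Aᴴ) a b =
      ∑ c : σ, ∑ y : σ, A a y * (starRingEnd ℂ) (A b c) *
        ∑ k : Fin n, ∑ i : Fin n → σ,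
          if i k = c then (starRingEnd ℂ) (S i) * S (Function.update i k y) else 0 := by
    rw [Matrix.mul_apply]
    refine Finset.sum_congr rfl fun c _ => ?_
    rw [Matrix.mul_apply, Matrix.conjTranspose_apply, Finset.sum_mul]
    refine Finset.sum_congr rfl fun y _ => ?_
    rw [momentMatrix_apply]
    have h4 : ∀ k : Fin n, (∑ j : Fin n → σ,
        if j k = y then (starRingEnd ℂ) (S (Function.update j k c)) * S j else 0) =
        ∑ i : Fin n → σ, if i k = c then (starRingEnd ℂ) (S i) * S (Function.update i k y) else 0 :=
      fun k => (sum_ite_apply_eq_update_swap (fun u v => (starRingEnd ℂ) (S u) * S v) k c y).symm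
    simp_rw [h4]
    rw [RCLike.star_def]
    ring
  rw [hL, hR]
  -- Step 4: regroup `∑ k ∑ i ∑ y F (i k) ...` as `∑ c ∑ y ∑ k ∑ i [i k = c] ...`
  symm
  calc (∑ c : σ, ∑ y : σ, A a y * (starRingEnd ℂ) (A b c) *
        ∑ k : Fin n, ∑ i : Fin n → σ,
          if i k = c then (starRingEnd ℂ) (S i) * S (Function.update i k y) else 0)
      = ∑ c : σ, ∑ y : σ, ∑ k : Fin n, ∑ i : Fin n → σ,
          if i k = c then A a y * (starRingEnd ℂ) (A b c) *
            ((starRingEnd ℂ) (S i) * S (Function.update i k y)) else 0 := by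
        refine Finset.sum_congr rfl fun c _ => Finset.sum_congr rfl fun y _ => ?_
        rw [Finset.mul_sum]
        refine Finset.sum_congr rfl fun k _ => ?_
        rw [Finset.mul_sum]
        refine Finset.sum_congr rfl fun i _ => ?_
        rw [mul_ite, mul_zero]
    _ = ∑ k : Fin n, ∑ i : Fin n → σ, ∑ y : σ, ∑ c : σ,
          if i k = c then A a y * (starRingEnd ℂ) (A b c) *
            ((starRingEnd ℂ) (S i) * S (Function.update i k y)) else 0 := by
        -- `∑ c ∑ y ∑ k ∑ i = ∑ k ∑ i ∑ y ∑ c`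
        have e1 : ∀ c : σ, (∑ y : σ, ∑ k : Fin n, ∑ i : Fin n → σ,
            if i k = c then A a y * (starRingEnd ℂ) (A b c) *
              ((starRingEnd ℂ) (S i) * S (Function.update i k y)) else 0) =
            ∑ k : Fin n, ∑ i : Fin n → σ, ∑ y : σ,
              if i k = c then A a y * (starRingEnd ℂ) (A b c) *
                ((starRingEnd ℂ) (S i) * S (Function.update i k y)) else 0 := by
          intro c
          rw [Finset.sum_comm]
          refine Finset.sum_congr rfl fun k _ => ?_
          rw [Finset.sum_comm]
        simp_rw [e1]
        rw [Finset.sum_comm]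
        refine Finset.sum_congr rfl fun k _ => ?_
        rw [Finset.sum_comm]
        refine Finset.sum_congr rfl fun i _ => ?_
        rw [Finset.sum_comm]
    _ = ∑ k : Fin n, ∑ i : Fin n → σ, ∑ y : σ,
          (starRingEnd ℂ) (A b (i k)) * A a y *
            ((starRingEnd ℂ) (S i) * S (Function.update i k y)) := by
        refine Finset.sum_congr rfl fun k _ => Finset.sum_congr rfl fun i _ =>
          Finset.sum_congr rfl fun y _ => ?_
        rw [Finset.sum_ite_eq Finset.univ (i k), if_pos (Finset.mem_univ _)]
        ring

/-- **Criticality ⇒ balanced weights in every unitary frame**: if `mom T₀` is scalar then for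
every unitary `U` and every real `θ` with `∑ θ = 0`,
`∑ j, (∑ k, θ (j k)) * ‖(U • T₀) j‖² = 0`. [folklore] -/
theorem weightSum_tensorAct_eq_zero_of_momentMatrix_eq_smul_one {T₀ : (Fin n → σ) → ℂ} {c : ℂ}
    (hT : momentMatrix T₀ = c • (1 : Matrix σ σ ℂ)) {U : Matrix σ σ ℂ}
    (hU : U ∈ Matrix.unitaryGroup σ ℂ) (θ : σ → ℝ) (hθ : ∑ a, θ a = 0) :
    ∑ j : Fin n → σ, (∑ k, θ (j k)) * ‖tensorAct U T₀ j‖ ^ 2 = 0 := by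
  have hU' : Uᴴ * U = 1 := by
    have := Matrix.mem_unitaryGroup_iff'.mp hU
    rwa [Matrix.star_eq_conjTranspose] at this
  have hU'' : U * Uᴴ = 1 := by
    have := Matrix.mem_unitaryGroup_iff.mp hU
    rwa [Matrix.star_eq_conjTranspose] at this
  refine weightSum_eq_zero_of_momentMatrix_eq_smul_one (tensorAct U T₀) (c := c) ?_ θ hθ
  rw [momentMatrix_tensorAct_of_conjTranspose_mul_self hU', hT, Matrix.mul_smul, Matrix.mul_one,
    Matrix.smul_mul, hU'']


end Literature.Computability.AlgebraicComplexity
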